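import Mathlib
import Literature.Analysis.FluidPDE.HardSphereCollisionRecord
import Literature.MathematicalPhysics.KineticTheory.HardSphereEuler
import Literature.MathematicalPhysics.KineticTheory.HardSphereEulerProofs
import Summits.AtomisticToContinuum.HydrodynamicLimit.Theorems.OneFlightGossipEngineOneFlightLayeredChaosRegimes
import Summits.AtomisticToContinuum.HydrodynamicLimit.Theorems.OneFlightGossipEngineOneFlightLayeredChaosPairMeasurable
import Summits.AtomisticToContinuum.HydrodynamicLimit.Theorems.OneFlightGossipEngineOneFlightLayeredChaosFirstFlightGhostGlue
import HarnessLib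

/-!
# `OneFlightGossipEngine.OneFlightLayeredChaos` — ghost-environment identification of the first-flight event, II: the ghost input
(crux stmt-AtomisticToContinuum-14535, line `Sketch`, reduction R2 of the first rung `stub_firstFlight_velInput`;
registered stub `firstFlightGhostEvent_measurableSet`; stub worker of lead cycle c3, wave 3, 2026-08-17).

* `freeEntranceTime ε z i j` — the ENTRANCE TIME `t⋆` of the two free flights of `i` and `j`: the least `t > 0` with
  `‖sepVec (x_i + t v_i) (x_j + t v_j)‖ ≤ ε` (an `sInf`, junk `0`), with its elementary API;
* `firstFlight_of_ghost` (←) — if the entrance time `t⋆` of the free flights of `i ≠ j` is positive and during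
  `(0, t⋆]` every ghost particle (the other `N − 1` spheres evolved WITHOUT `i, j` by a hard-sphere flow `Ψ`) stays at
  distance `> ε` from both free flights, then the first collision of `i` happens at `t⋆`, with `j`, and `j` is fresh
  (first deviation time + hard core + binary collisions);
* `firstFlightGhostEvent Ψ i j emb w` — the GHOST EVENT `{z ∘ emb ∈ Ψ.good} ∩ {t⋆ ∈ (0, w]} ∩ {ghost avoidance on
  (0, t⋆]}`: an explicit functional of the time-`0` data `(x_i, v_i, x_j, v_j)` and of the ghost orbit of the others, in
  which the `N`-body flow `Φ` no longer appears; `good_inter_firstFlightGhostEvent_eq`: on `Φ.good` it IS the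
  first-flight event of the pair (up to the `Ψ`-good restriction), hence measurable there
  (`firstFlightGhostEvent_measurableSet`);
* `FirstFlightGhostInput θ₀` — the typed hypothesis `FirstFlightVelInput θ₀` of `…FirstFlightVelInput` with the
  first-flight event replaced by the ghost event and the contact normal read at the entrance time;
The transfer `FirstFlightGhostInput θ₀ → FirstFlightVelInput θ₀` is `…FirstFlightGhostTransfer`.
-/

open scoped BigOperators ENNReal Topology
open MeasureTheory Set Filter
open Literature.Analysis.FluidPDE Literature.MathematicalPhysics.KineticTheory
open Summit.AtomisticToContinuum.HydrodynamicLimit.Theorems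

namespace Summit.AtomisticToContinuum.HydrodynamicLimit.Theorems.OLC

noncomputable section

/-! ## The entrance time of two free flights -/

section Entrance

variable {n : ℕ}

/-- The **entrance time** of the free flights of `i` and `j` issued from the configuration `z` on `𝕋³`: the least
`t > 0` at which `x_i + t v_i` and `x_j + t v_j` are within (minimal-image) distance `ε` — an `sInf`, with junk value
`0` when the two free flights never come within `ε` after time `0` (and possibly `0` when they do so immediately). On the
first-flight event of the pair it is the first collision time of `i` (`firstFlightEvent_subset_ghost`). [folklore] -/
def freeEntranceTime (ε : ℝ) (z : Config n (Fin 3) T3) (i j : Fin n) : ℝ :=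
  sInf {t : ℝ | 0 < t ∧ ‖(Torus.geometry (Fin 3)).sepVec (freeFlight (Torus.geometry (Fin 3)) t z i).1
    (freeFlight (Torus.geometry (Fin 3)) t z j).1‖ ≤ ε}

/-- **A positive entrance time is attained**: it is the least `t > 0` with the two free flights within `ε`.
[folklore] -/
theorem isLeast_freeEntranceTime {ε : ℝ} {z : Config n (Fin 3) T3} {i j : Fin n}
    (h : 0 < freeEntranceTime ε z i j) :
    IsLeast {t : ℝ | 0 < t ∧ ‖(Torus.geometry (Fin 3)).sepVec (freeFlight (Torus.geometry (Fin 3)) t z i).1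
      (freeFlight (Torus.geometry (Fin 3)) t z j).1‖ ≤ ε} (freeEntranceTime ε z i j) :=
  isLeast_sInf_of_pos (continuous_norm_sepVec_freeFlight z i j) h

/-- The entrance time is characterised by the least-element property. [folklore] -/
theorem freeEntranceTime_eq_of_isLeast {ε : ℝ} {z : Config n (Fin 3) T3} {i j : Fin n} {t : ℝ}
    (h : IsLeast {t : ℝ | 0 < t ∧ ‖(Torus.geometry (Fin 3)).sepVec (freeFlight (Torus.geometry (Fin 3)) t z i).1
      (freeFlight (Torus.geometry (Fin 3)) t z j).1‖ ≤ ε} t) :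
    freeEntranceTime ε z i j = t :=
  h.csInf_eq

/-- **At a positive entrance time the two free flights are exactly at distance `ε`.** [folklore] -/
theorem norm_sepVec_freeFlight_freeEntranceTime {ε : ℝ} {z : Config n (Fin 3) T3} {i j : Fin n}
    (h : 0 < freeEntranceTime ε z i j) :
    ‖(Torus.geometry (Fin 3)).sepVec (freeFlight (Torus.geometry (Fin 3)) (freeEntranceTime ε z i j) z i).1
      (freeFlight (Torus.geometry (Fin 3)) (freeEntranceTime ε z i j) z j).1‖ = ε :=
  eq_of_isLeast_pos (continuous_norm_sepVec_freeFlight z i j) (isLeast_freeEntranceTime h)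

/-- **Before a positive entrance time the two free flights are at distance `> ε`.** [folklore] -/
theorem lt_norm_sepVec_freeFlight_of_lt_freeEntranceTime {ε : ℝ} {z : Config n (Fin 3) T3} {i j : Fin n}
    (h : 0 < freeEntranceTime ε z i j) {u : ℝ} (hu : u ∈ Ioo 0 (freeEntranceTime ε z i j)) :
    ε < ‖(Torus.geometry (Fin 3)).sepVec (freeFlight (Torus.geometry (Fin 3)) u z i).1
      (freeFlight (Torus.geometry (Fin 3)) u z j).1‖ :=
  lt_of_isLeast_pos (isLeast_freeEntranceTime h) hu


end Entrance

/-! ## The converse inclusion: the ghost event lies in the first-flight event -/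

section Converse

variable {σ : ℝ} {N m : ℕ} (Φ : HardSphereFlow (Torus.geometry (Fin 3)) (hsDiameter σ N) (N + 1))
  (Ψ : HardSphereFlow (Torus.geometry (Fin 3)) (hsDiameter σ N) m) {i j : Fin (N + 1)} (emb : Fin m ↪ Fin (N + 1))
  {z : Config (N + 1) (Fin 3) T3}

/-- **Free pair, ghost environment.** If on a good orbit neither `i` nor `j` takes part in a collision during
`(0, T)` (`T > 0`) and the restriction `z ∘ emb` to the other labels is good for `Ψ`, then on `[0, T]` the two
particles are at their free-flight positions and AT time `T` the other particles are at the positions of the ghost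
orbit `Ψ_T (z ∘ emb)` (subsystem lemma on `[0, u]` for every `u < T`, then continuity of positions at `T`).
[folklore] -/
theorem pos_eq_of_free_pair (hemb : ∀ k : Fin (N + 1), (∃ l, emb l = k) ↔ (k ≠ i ∧ k ≠ j)) (hz : z ∈ Φ.good)
    (hzm : (z ∘ emb : Config m (Fin 3) T3) ∈ Ψ.good) {T : ℝ} (hT : 0 < T)
    (hfree : ∀ u ∈ Ioo 0 T, ¬ Participates (Torus.geometry (Fin 3)) (hsDiameter σ N) (Φ.flow u z) i ∧
      ¬ Participates (Torus.geometry (Fin 3)) (hsDiameter σ N) (Φ.flow u z) j) :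
    (∀ t ∈ Icc 0 T, (Φ.flow t z i).1 = (freeFlight (Torus.geometry (Fin 3)) t z i).1 ∧
      (Φ.flow t z j).1 = (freeFlight (Torus.geometry (Fin 3)) t z j).1) ∧
    ∀ l : Fin m, (Φ.flow T z (emb l)).1 = (Ψ.flow T (z ∘ emb) l).1 := by
  have hγ := Φ.isTrajectory z hz
  have hγm := Ψ.isTrajectory _ hzm
  refine ⟨fun t ht => ⟨pos_eq_freeFlight_of_forall_not_participates Φ hz i hT.le (fun u hu => (hfree u hu).1) ht,
    pos_eq_freeFlight_of_forall_not_participates Φ hz j hT.le (fun u hu => (hfree u hu).2) ht⟩, fun l => ?_⟩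
  have h1 : Tendsto (fun u => (Φ.flow u z (emb l)).1) (𝓝[<] T) (𝓝 (Φ.flow T z (emb l)).1) :=
    ((hγ.pos_continuous (emb l)).tendsto T).mono_left nhdsWithin_le_nhds
  have h2 : Tendsto (fun u => (Ψ.flow u (z ∘ emb) l).1) (𝓝[<] T) (𝓝 (Ψ.flow T (z ∘ emb) l).1) :=
    ((hγm.pos_continuous l).tendsto T).mono_left nhdsWithin_le_nhds
  have heq : (fun u => (Φ.flow u z (emb l)).1) =ᶠ[𝓝[<] T] fun u => (Ψ.flow u (z ∘ emb) l).1 := by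
    filter_upwards [Ioo_mem_nhdsLT hT] with u hu
    have hnc : ∀ τ ∈ Ioc 0 u, ∀ I J : Fin (N + 1), I ≠ J →
        Φ.flow τ z ∈ contactSet (Torus.geometry (Fin 3)) (N + 1) (hsDiameter σ N) I J →
        ((∃ l, emb l = I) ↔ (∃ l, emb l = J)) := by
      intro τ hτ I J hIJ hc
      have hτ' : τ ∈ Ioo 0 T := ⟨hτ.1, hτ.2.trans_lt hu.2⟩
      have hpI : Participates (Torus.geometry (Fin 3)) (hsDiameter σ N) (Φ.flow τ z) I :=
        ⟨J, Or.inl (mem_contactPairs.2 ⟨hIJ, hc⟩)⟩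
      have hpJ : Participates (Torus.geometry (Fin 3)) (hsDiameter σ N) (Φ.flow τ z) J :=
        ⟨I, Or.inr (mem_contactPairs.2 ⟨hIJ, hc⟩)⟩
      have hI : I ≠ i ∧ I ≠ j :=
        ⟨fun h => (hfree τ hτ').1 (h ▸ hpI), fun h => (hfree τ hτ').2 (h ▸ hpI)⟩
      have hJ : J ≠ i ∧ J ≠ j :=
        ⟨fun h => (hfree τ hτ').1 (h ▸ hpJ), fun h => (hfree τ hτ').2 (h ▸ hpJ)⟩
      exact iff_of_true ((hemb I).2 hI) ((hemb J).2 hJ)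
    have key := congrFun (flow_comp_emb_eq emb Torus.continuous_geometry_translate Ψ Φ hz hzm hnc u
      ⟨hu.1.le, le_rfl⟩) l
    show (Φ.flow u z (emb l)).1 = (Ψ.flow u (z ∘ emb) l).1
    rw [← key]
    rfl
  exact tendsto_nhds_unique (h1.congr' heq) h2


/-- **(←) The ghost event lies in the first-flight event.** On a good orbit whose restriction to the labels other
than `{i, j}` (`i ≠ j`) is good for the ghost flow `Ψ`: if the entrance time `t⋆` of the two free flights is positive
and during `(0, t⋆]` every ghost particle stays at distance `> ε` from both free flights, then the first collision of
`i` after time `0` happens at `t⋆`, with partner `j`, and neither `i` nor `j` takes part in a collision during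
`(0, t⋆)`. Proof: at the first time `T < t⋆` at which `i` or `j` would take part in a collision, the two particles
are at their free-flight positions and the others at the ghost positions (`pos_eq_of_free_pair`), so the contact
would be a contact of the two free flights before `t⋆` (least-element property) or of a ghost particle with a free
flight (avoidance) — impossible; hence `i`, `j` fly freely on `[0, t⋆]`, are at distance `ε` at `t⋆`
(`norm_sepVec_freeFlight_freeEntranceTime`), and binary collisions identify the partner. [folklore] -/
theorem firstFlight_of_ghost (hij : i ≠ j) (hemb : ∀ k : Fin (N + 1), (∃ l, emb l = k) ↔ (k ≠ i ∧ k ≠ j))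
    (hz : z ∈ Φ.good) (hzm : (z ∘ emb : Config m (Fin 3) T3) ∈ Ψ.good)
    (ht : 0 < freeEntranceTime (hsDiameter σ N) z i j)
    (havoid : ∀ u ∈ Ioc 0 (freeEntranceTime (hsDiameter σ N) z i j), ∀ k : Fin m,
      hsDiameter σ N < ‖(Torus.geometry (Fin 3)).sepVec (Ψ.flow u (z ∘ emb) k).1
        (freeFlight (Torus.geometry (Fin 3)) u z i).1‖ ∧
      hsDiameter σ N < ‖(Torus.geometry (Fin 3)).sepVec (Ψ.flow u (z ∘ emb) k).1
        (freeFlight (Torus.geometry (Fin 3)) u z j).1‖) :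
    Φ.nthCollisionTimeOf i 0 z = freeEntranceTime (hsDiameter σ N) z i j ∧ Φ.nthPartnerOf i 0 z = j ∧
      ∀ u ∈ Ioo 0 (freeEntranceTime (hsDiameter σ N) z i j),
        ¬ Participates (Torus.geometry (Fin 3)) (hsDiameter σ N) (Φ.flow u z) i ∧
        ¬ Participates (Torus.geometry (Fin 3)) (hsDiameter σ N) (Φ.flow u z) j := by
  classical
  set tS := freeEntranceTime (hsDiameter σ N) z i j with htSdef
  have hγ := Φ.isTrajectory z hz
  have hεt := norm_sepVec_freeFlight_freeEntranceTime ht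
  have hbefore : ∀ u ∈ Ioo 0 tS, hsDiameter σ N < ‖(Torus.geometry (Fin 3)).sepVec
      (freeFlight (Torus.geometry (Fin 3)) u z i).1 (freeFlight (Torus.geometry (Fin 3)) u z j).1‖ :=
    fun u hu => lt_norm_sepVec_freeFlight_of_lt_freeEntranceTime ht hu
  -- the finite set of times in `(0, t⋆)` at which `i` or `j` takes part in a collision is empty
  set B : Finset ℝ := (hγ.locFinite 0 tS).toFinset.filter fun u => 0 < u ∧ u < tS ∧
    (Participates (Torus.geometry (Fin 3)) (hsDiameter σ N) (Φ.flow u z) i ∨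
      Participates (Torus.geometry (Fin 3)) (hsDiameter σ N) (Φ.flow u z) j) with hBdef
  have hmemB : ∀ {u : ℝ}, u ∈ B ↔ (u ∈ collisionTimes (Torus.geometry (Fin 3)) (hsDiameter σ N)
      (fun t => Φ.flow t z) ∧ u ∈ Icc 0 tS) ∧ 0 < u ∧ u < tS ∧
      (Participates (Torus.geometry (Fin 3)) (hsDiameter σ N) (Φ.flow u z) i ∨
        Participates (Torus.geometry (Fin 3)) (hsDiameter σ N) (Φ.flow u z) j) := by
    intro u
    rw [hBdef, Finset.mem_filter, Set.Finite.mem_toFinset]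
    rfl
  have hBmem : ∀ u ∈ Ioo 0 tS, ¬ (¬ Participates (Torus.geometry (Fin 3)) (hsDiameter σ N) (Φ.flow u z) i ∧
      ¬ Participates (Torus.geometry (Fin 3)) (hsDiameter σ N) (Φ.flow u z) j) → u ∈ B := by
    intro u hu hcon
    have hor : Participates (Torus.geometry (Fin 3)) (hsDiameter σ N) (Φ.flow u z) i ∨
        Participates (Torus.geometry (Fin 3)) (hsDiameter σ N) (Φ.flow u z) j := by tauto
    have hcolu : u ∈ collisionTimes (Torus.geometry (Fin 3)) (hsDiameter σ N) (fun t => Φ.flow t z) := by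
      rcases hor with h | h
      · exact collisionTimesOf_subset _ i h
      · exact collisionTimesOf_subset _ j h
    exact hmemB.2 ⟨⟨hcolu, hu.1.le, hu.2.le⟩, hu.1, hu.2, hor⟩
  have hfreeAll : ∀ u ∈ Ioo 0 tS, ¬ Participates (Torus.geometry (Fin 3)) (hsDiameter σ N) (Φ.flow u z) i ∧
      ¬ Participates (Torus.geometry (Fin 3)) (hsDiameter σ N) (Φ.flow u z) j := by
    intro u hu
    by_contra hcon
    have hne : B.Nonempty := ⟨u, hBmem u hu hcon⟩
    obtain ⟨-, h0T, hTt, hPT⟩ := hmemB.1 (B.min'_mem hne)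
    set T := B.min' hne with hTdef
    -- before `T` neither particle takes part in a collision
    have hfreeT : ∀ u ∈ Ioo 0 T, ¬ Participates (Torus.geometry (Fin 3)) (hsDiameter σ N) (Φ.flow u z) i ∧
        ¬ Participates (Torus.geometry (Fin 3)) (hsDiameter σ N) (Φ.flow u z) j := by
      intro u' hu'
      by_contra hcon'
      exact (not_le.2 hu'.2) (B.min'_le u' (hBmem u' ⟨hu'.1, hu'.2.trans hTt⟩ hcon'))
    obtain ⟨hpos, hgh⟩ := pos_eq_of_free_pair Φ Ψ emb hemb hz hzm h0T hfreeT
    have hposT := hpos T ⟨h0T.le, le_rfl⟩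
    have havT := havoid T ⟨h0T, hTt.le⟩
    -- a contact at `T` touching `i` or `j` is impossible
    have hcontra : ∀ a b : Fin (N + 1), a ≠ b →
        ‖(Torus.geometry (Fin 3)).sepVec (Φ.flow T z a).1 (Φ.flow T z b).1‖ = hsDiameter σ N →
        (a = i ∨ a = j) → False := by
      intro a b hab hnorm ha
      by_cases hb : b ≠ i ∧ b ≠ j
      · obtain ⟨l, rfl⟩ := (hemb b).2 hb
        rw [hgh l] at hnorm
        rcases ha with ha | ha
        · rw [ha, hposT.1, norm_sepVec_comm] at hnorm
          have := (havT l).1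
          rw [hnorm] at this
          exact lt_irrefl _ this
        · rw [ha, hposT.2, norm_sepVec_comm] at hnorm
          have := (havT l).2
          rw [hnorm] at this
          exact lt_irrefl _ this
      · have hb' : b = i ∨ b = j := by tauto
        have key : ‖(Torus.geometry (Fin 3)).sepVec (freeFlight (Torus.geometry (Fin 3)) T z i).1
            (freeFlight (Torus.geometry (Fin 3)) T z j).1‖ = hsDiameter σ N := by
          rcases ha with ha | ha <;> rcases hb' with hb' | hb'
          · exact absurd (ha.trans hb'.symm) hab
          · rwa [ha, hb', hposT.1, hposT.2] at hnorm
          · rwa [ha, hb', hposT.1, hposT.2, norm_sepVec_comm] at hnorm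
          · exact absurd (ha.trans hb'.symm) hab
        have := hbefore T ⟨h0T, hTt⟩
        rw [key] at this
        exact lt_irrefl _ this
    rcases hPT with ⟨l', hcol⟩ | ⟨l', hcol⟩
    · rcases hcol with h1 | h2
      · obtain ⟨hne, hc⟩ := mem_contactPairs.1 h1
        exact hcontra i l' hne (mem_contactSet.1 hc).2 (Or.inl rfl)
      · obtain ⟨hne, hc⟩ := mem_contactPairs.1 h2
        exact hcontra i l' (Ne.symm hne) (by rw [norm_sepVec_comm]; exact (mem_contactSet.1 hc).2) (Or.inl rfl)
    · rcases hcol with h1 | h2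
      · obtain ⟨hne, hc⟩ := mem_contactPairs.1 h1
        exact hcontra j l' hne (mem_contactSet.1 hc).2 (Or.inr rfl)
      · obtain ⟨hne, hc⟩ := mem_contactPairs.1 h2
        exact hcontra j l' (Ne.symm hne) (by rw [norm_sepVec_comm]; exact (mem_contactSet.1 hc).2) (Or.inr rfl)
  -- hence the two particles fly freely on `[0, t⋆]` and touch at `t⋆`
  obtain ⟨hpos, -⟩ := pos_eq_of_free_pair Φ Ψ emb hemb hz hzm ht hfreeAll
  have hposS := hpos tS ⟨ht.le, le_rfl⟩
  have hcontact : (i, j) ∈ contactPairs (Torus.geometry (Fin 3)) (hsDiameter σ N) (Φ.flow tS z) :=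
    mem_contactPairs.2 ⟨hij, mem_contactSet.2 ⟨hγ.mem tS, by rw [hposS.1, hposS.2]; exact hεt⟩⟩
  have hparti : Participates (Torus.geometry (Fin 3)) (hsDiameter σ N) (Φ.flow tS z) i := ⟨j, Or.inl hcontact⟩
  have hleast : IsLeast (collisionTimesOf (Torus.geometry (Fin 3)) (hsDiameter σ N) (fun t => Φ.flow t z) i ∩
      Ioi 0) tS := by
    refine ⟨⟨hparti, ht⟩, fun s hs => ?_⟩
    by_contra hlt
    rw [not_le] at hlt
    exact (hfreeAll s ⟨hs.2, hlt⟩).1 hs.1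
  have ht₀ : Φ.nthCollisionTimeOf i 0 z = tS := (hγ.isLeast_nthCollisionTimeOf_zero ⟨tS, hparti, ht⟩).unique hleast
  refine ⟨ht₀, ?_, hfreeAll⟩
  show partner (Torus.geometry (Fin 3)) (hsDiameter σ N) (Φ.flow (Φ.nthCollisionTimeOf i 0 z) z) i = j
  rw [ht₀]
  exact (hγ.partner_eq hcontact).1


end Converse

/-! ## The ghost event and the ghost input -/

section Ghost

variable {σ : ℝ} {N m : ℕ}

/-- The **ghost event** of the pair `(i, j)` with window `w`, ghost flow `Ψ` (a hard-sphere flow of the `m = N − 1`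
other spheres) and enumeration `emb` of the labels `∉ {i, j}`: the restriction `z ∘ emb` is `Ψ`-good, the entrance
time `t⋆` of the two free flights of `i` and `j` lies in `(0, w]`, and during `(0, t⋆]` every ghost particle
`Ψ_u (z ∘ emb) k` stays at minimal-image distance `> ε` from both free flights `x_i + u v_i`, `x_j + u v_j`. The
`(N+1)`-body flow does not enter; on its good set this is the first-flight event of the pair
(`good_inter_firstFlightGhostEvent_eq`). [folklore] -/
def firstFlightGhostEvent (Ψ : HardSphereFlow (Torus.geometry (Fin 3)) (hsDiameter σ N) m) (i j : Fin (N + 1))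
    (emb : Fin m ↪ Fin (N + 1)) (w : ℝ) : Set (Config (N + 1) (Fin 3) T3) :=
  {z | (z ∘ emb : Config m (Fin 3) T3) ∈ Ψ.good ∧ freeEntranceTime (hsDiameter σ N) z i j ∈ Set.Ioc 0 w ∧
    ∀ u ∈ Set.Ioc 0 (freeEntranceTime (hsDiameter σ N) z i j), ∀ k : Fin m,
      hsDiameter σ N < ‖(Torus.geometry (Fin 3)).sepVec (Ψ.flow u (z ∘ emb) k).1
        (freeFlight (Torus.geometry (Fin 3)) u z i).1‖ ∧
      hsDiameter σ N < ‖(Torus.geometry (Fin 3)).sepVec (Ψ.flow u (z ∘ emb) k).1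
        (freeFlight (Torus.geometry (Fin 3)) u z j).1‖}

/-- **First-flight GHOST input (the typed dynamical input of the first rung, ghost-environment form).** The statement
`FirstFlightVelInput θ₀` (`…FirstFlightVelInput`: velocities frozen, positions distributed by the hard-core-uniform law
`μ = posGibbsMeasure 1 ε (N+1)`, fixed pair `j ≠ i`, window `w = τ (N+1)^{-1/3}`, `ℓ`-cells `q`) in which the
`(N+1)`-body flow no longer appears: the first-flight event `F` of the pair is replaced by the GHOST EVENT
`firstFlightGhostEvent Ψ i j emb w` — the entrance time `t⋆(x_i, v_i, x_j, v_j)` of the two free flights lies in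
`(0, w]` and the other `N − 1` spheres, evolved on their own by ANY hard-sphere flow `Ψ` ("ghost environment",
labels enumerated by any `emb`), avoid the two free flights during `(0, t⋆]` —, and the contact normal is read at the
entrance time, `ω = ε⁻¹ sepVec (x_i + t⋆ v_i) (x_j + t⋆ v_j)`; everything else (`μ`, `γ`, cells, flux functional, the
weight `b` with `∫ b dγ ≤ C σ^p/(N+1)`) is unchanged. For `P`-a.e. datum the two events coincide
(`good_inter_firstFlightGhostEvent_eq`, `ae_comp_emb_mem_good`), whence `FirstFlightGhostInput θ₀ → FirstFlightVelInput θ₀`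
(`firstFlightVelInput_of_ghostInput`). A typed HYPOTHESIS of the line (a named `Prop` the route posits; nothing is
asserted, it is not a published fact). -/
def FirstFlightGhostInput (θ₀ : ℝ) : Prop :=
  ∃ C : ℝ, 0 < C ∧ ∃ p : ℝ, 0 < p ∧ ∃ σ₀ : ℝ, 0 < σ₀ ∧ ∀ σ : ℝ, 0 < σ → σ < σ₀ →
  ∀ τ : ℝ, 0 < τ → ∃ N₀ : ℕ, ∀ N : ℕ, N₀ ≤ N →
    ∀ Ψ : HardSphereFlow (Torus.geometry (Fin 3)) (hsDiameter σ N) (N - 1),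
    ∀ (i j : Fin (N + 1)), j ≠ i →
    ∀ emb : Fin (N - 1) ↪ Fin (N + 1), (∀ k : Fin (N + 1), (∃ l, emb l = k) ↔ (k ≠ i ∧ k ≠ j)) →
    let G : Geometry (Fin 3) T3 := Torus.geometry (Fin 3)
    let ε : ℝ := hsDiameter σ N
    let w : ℝ := τ * ((N + 1 : ℕ) : ℝ) ^ (-(1 / 3 : ℝ))
    let q : T3 → (Fin 3 → ℤ) := Torus.coarseCell (rhoStar σ * ((N + 1 : ℕ) : ℝ) ^ (-(1 / 3 : ℝ)))
    let μ : Measure (Fin (N + 1) → T3) := posGibbsMeasure (fun _ => 1) ε (N + 1)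
    let γ : Measure (Fin (N + 1) → V3) := Measure.pi fun _ => gaussMeasure (0 : V3) θ₀
    let tE : Config (N + 1) (Fin 3) T3 → ℝ := fun z => freeEntranceTime ε z i j
    let F : Set (Config (N + 1) (Fin 3) T3) := firstFlightGhostEvent Ψ i j emb w
    let ωPair : Config (N + 1) (Fin 3) T3 → V3 := fun z =>
      ε⁻¹ • G.sepVec (freeFlight G (tE z) z i).1 (freeFlight G (tE z) z j).1
    let flux : V3 → Set V3 → ℝ := fun g U =>
      ((∫⁻ ω, U.indicator (fun _ => (1 : ℝ≥0∞)) (ω : V3) * ENNReal.ofReal (max (-inner ℝ (ω : V3) g) 0)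
          ∂(sphereMeasure (E := V3))) /
        (∫⁻ ω, ENNReal.ofReal (max (-inner ℝ (ω : V3) g) 0) ∂(sphereMeasure (E := V3)))).toReal
    ∃ b : (Fin (N + 1) → V3) → ℝ, Integrable b γ ∧ ∫ v, b v ∂γ ≤ C * σ ^ p / (N + 1) ∧
      ∀ (v : Fin (N + 1) → V3) (U : Set V3), MeasurableSet U →
      ∀ T : Set (Fin (N + 1) → (Fin 3 → ℤ)), MeasurableSet T →
        |(μ {x | zipConfig (x, v) ∈ F ∧ ωPair (zipConfig (x, v)) ∈ U ∧ (fun k => q (x k)) ∈ T}).toReal -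
            flux (‖v i - v j‖⁻¹ • (v i - v j)) U *
              (μ {x | zipConfig (x, v) ∈ F ∧ (fun k => q (x k)) ∈ T}).toReal| ≤ b v

variable (Φ : HardSphereFlow (Torus.geometry (Fin 3)) (hsDiameter σ N) (N + 1))
  (Ψ : HardSphereFlow (Torus.geometry (Fin 3)) (hsDiameter σ N) m) {i j : Fin (N + 1)} (emb : Fin m ↪ Fin (N + 1))

/-- **On the good set of the `(N+1)`-body flow the ghost event is the first-flight event of the pair** (restricted to
the data whose ghost part is `Ψ`-good): `Φ.good ∩ ghost = {z ∘ emb ∈ Ψ.good} ∩ F`, `F = Φ.good ∩ {t₀ ∈ (0, w],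
partner j, j fresh}` (`firstFlight_of_ghost`, `firstFlightEvent_subset_ghost`). [folklore] -/
theorem good_inter_firstFlightGhostEvent_eq (hij : i ≠ j)
    (hemb : ∀ k : Fin (N + 1), (∃ l, emb l = k) ↔ (k ≠ i ∧ k ≠ j)) (w : ℝ) :
    Φ.good ∩ firstFlightGhostEvent Ψ i j emb w =
      {z | (z ∘ emb : Config m (Fin 3) T3) ∈ Ψ.good} ∩
        (Φ.good ∩ {z : Config (N + 1) (Fin 3) T3 | Φ.nthCollisionTimeOf i 0 z ∈ Set.Ioc 0 w ∧
          Φ.nthPartnerOf i 0 z = j ∧ ∀ u ∈ Set.Ioo 0 (Φ.nthCollisionTimeOf i 0 z),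
            ¬ Participates (Torus.geometry (Fin 3)) (hsDiameter σ N) (Φ.flow u z) j}) := by
  ext z
  constructor
  · rintro ⟨hz, hzm, htw, hav⟩
    obtain ⟨ht₀, hj, hfree⟩ := firstFlight_of_ghost Φ Ψ emb hij hemb hz hzm htw.1 hav
    refine ⟨hzm, hz, ?_, hj, fun u hu => ?_⟩
    · rw [ht₀]
      exact htw
    · rw [ht₀] at hu
      exact (hfree u hu).2
  · rintro ⟨hzm, hz, htw, hj, hfresh⟩
    obtain ⟨htE, hav⟩ := firstFlightEvent_subset_ghost Φ Ψ emb hemb hz hzm htw.1 hj hfresh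
    have htE' : freeEntranceTime (hsDiameter σ N) z i j = Φ.nthCollisionTimeOf i 0 z := htE
    refine ⟨hz, hzm, ?_, ?_⟩
    · rw [htE']
      exact htw
    · rw [htE']
      exact hav

/-- **The ghost event is measurable on the good set of any `(N+1)`-body flow** (it is the first-flight event of the
pair there, `good_inter_firstFlightGhostEvent_eq`, `measurableSet_firstFlightPairEvent`). [folklore] -/
theorem firstFlightGhostEvent_measurableSet : ∀ {σ : ℝ} {N m : ℕ} (Φ : Literature.Analysis.FluidPDE.HardSphereFlow (Literature.Analysis.FluidPDE.Torus.geometry (Fin 3)) (Literature.MathematicalPhysics.KineticTheory.hsDiameter σ N) (N + 1)) (Ψ : Literature.Analysis.FluidPDE.HardSphereFlow (Literature.Analysis.FluidPDE.Torus.geometry (Fin 3)) (Literature.MathematicalPhysics.KineticTheory.hsDiameter σ N) m) {i j : Fin (N + 1)}, i ≠ j → ∀ (emb : Fin m ↪ Fin (N + 1)), (∀ k : Fin (N + 1), (∃ l, emb l = k) ↔ (k ≠ i ∧ k ≠ j)) → ∀ w : ℝ, MeasurableSet (Φ.good ∩ Summit.AtomisticToContinuum.HydrodynamicLimit.Theorems.OLC.firstFlightGhostEvent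 Ψ i j emb w) := by
  intro σ N m Φ Ψ i j hij emb hemb w
  rw [good_inter_firstFlightGhostEvent_eq Φ Ψ emb hij hemb w]
  exact ((measurable_comp_emb emb) Ψ.measurableSet_good).inter (measurableSet_firstFlightPairEvent Φ i j w)

end Ghost


end

end Summit.AtomisticToContinuum.HydrodynamicLimit.Theorems.OLC
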